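/-
Copyright (c) 2026 the pub-hodgecm-mathlib formalisation cell (harness21).  Prover seat hodgecm-mathlib-K2E3-p23 (g5), HCML Track B «K2-LIT» ∕ h413
(`stmt-HodgeConjecture-24833`), line `K2_E3_EllipticInputs`, unit U12 «Characters», road «GL-[M6]-sc» (line lead K2E3-p23 (g5), dealer K2E3-plan (g3)),
MEMO «M6sc-BLUEPRINT v4» §1 (ASM): the `hball` majorant at a MIXED-regular point of `G' = GL₃(F) ⧸ ϖ^ℤ`.  2026-09-04.
-/
import Summits.HodgeConjecture.HodgeConjecture.Theorems.K2E3GL3ModUniformizerVolumeTransfer     -- ★ «VOL-transfer» p858323 (K2E3-p03 g5): `setIntegral_norm_comp_conj_le_adBall`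
import Summits.HodgeConjecture.HodgeConjecture.Theorems.K2E3GL3MixedConjugacyVolume             -- ★ VOL-mixed C p858322 (this seat): `exists_measure_window_adBall_conj_leviBlock_le`
import Summits.HodgeConjecture.HodgeConjecture.Theorems.K2E3GL3TruncatedCharMixedTorusRadius    -- ★ T18-mixed p858307 (K2E3-p14 g5): `exists_adBall_mul_centralizer_of_conj_integral_mixed`
import Summits.HodgeConjecture.HodgeConjecture.Theorems.K2E3GL3ConjugacyCountShift               -- ★ p858344 (this seat): the conjugator shift
import HarnessLib

/-!
# Road «GL-[M6]-sc», ASM brick: THE BALL BOUND AT A MIXED-REGULAR POINT —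
# `∫_{Ω R} ‖θ(x̄ · mk(y·γ·y⁻¹) · x̄⁻¹)‖ dμ' ≤ M_θ · (c · C(m) · 3(2(R + L)+1)² · ‖c²/π(c)‖ · |2|⁻¹(q⁻¹)^{B−l+⌊l/2⌋})`, `γ = leviBlock(C_π, c)` (HC 1970, VII §3 p. 72 for `T_E`)

Cell `pub/hodgecm-mathlib` (D-0151), Track B «K2-LIT», crux H413 = `stmt-HodgeConjecture-24833`, route of record `HCCMUnconditional`.  Lane
`--supports stmt-HodgeConjecture-24833 --as helper`; THEOREMS ONLY (no `def`, no `instance`, no `notation`, no named-fact hypothesis, no `sorry`); count-neutral.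

The `hball` input of ★ ASM-core `nonEllEstimates_of_radius` at a point `x̄ = mk(y γ y⁻¹)`, `γ` the companion normal form `!![0, −N₀, 0; 1, T, 0; 0, 0, c]` of a mixed regular
element (`π = X² − TX + N₀` rootless, `c ≠ 0`, `π(c) ≠ 0`; RULINGS (M12-5)), the representative `y γ y⁻¹` INTEGRAL, `L` with `|ϖ^L| ≤ |disc π · π(c)²|`:
1. ★ «VOL-transfer» (K2E3-p03 g5): `∫_{Ω R} ‖θ(x̄ ḡ x̄⁻¹)‖ dμ' ≤ M_θ · (c · ν{h(det z) ∈ [−2,0] ∧ 𝔅_R(z) ∧ 𝔅_m(z g z⁻¹)}).toReal`;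
2. ★ T18-mixed (K2E3-p14 g5): a conjugator `y′ = y t`, `t ∈ Z(γ)`, of height `L`, so `g = y′ γ y′⁻¹`;
3. ★ shift (this seat): the count at `g` is at most the count at `γ` with window `W′` (`|W′| = 3`) and radius `R + L`;
4. ★ VOL-mixed FILE C (this seat): `≤ C(m) · 3(2(R+L)+1)² · ‖c²/π(c)‖ · |2|⁻¹ (q⁻¹)^{B − l + ⌊l/2⌋}`.
* **`exists_setIntegral_norm_conj_le_mixed`** — the bound, with ONE pair of constants `(c, C)` for all data.
HONEST LABEL: HC_CM is proved only modulo the 7 printed citations (2 remaining named inputs: hLiu418 = stmt-HodgeConjecture-24832, h413 = stmt-HodgeConjecture-24833) until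
rung 0 closes; count-neutral helper, closes no socket.

## References
* [HarishChandra1970] Harish-Chandra (notes by G. van Dijk), *Harmonic Analysis on Reductive p-adic Groups*, LNM 162 (1970), Part VII §2 Theorem 18 p. 69, §3 p. 72.
-/

set_option autoImplicit false
-- the mandated namespace repeats the single-problem summit's segment (`HodgeConjecture.HodgeConjecture`)
set_option linter.dupNamespace false

noncomputable section

open MeasureTheory Measure Set
open scoped MatrixGroups NNReal ENNReal WithZero
open Literature.NumberTheory.Automorphic Literature.NumberTheory.GaloisRepresentations Literature.NumberTheory.GaloisRepresentations.IsNonarchimedeanLocalField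
open Summit.HodgeConjecture.HodgeConjecture.Cruxes.H413.K2E3GLnAdHeightBalls Summit.HodgeConjecture.HodgeConjecture.Cruxes.H413.K2E3GL3ModUniformizerFundamentalDomain
open Summit.HodgeConjecture.HodgeConjecture.Cruxes.H413.K2E3GL3ModUniformizerVolumeTransfer Summit.HodgeConjecture.HodgeConjecture.Cruxes.H413.K2E3GL3MixedConjugacyVolume
open Summit.HodgeConjecture.HodgeConjecture.Cruxes.H413.K2E3GL3TruncatedCharMixedTorusRadius Summit.HodgeConjecture.HodgeConjecture.Cruxes.H413.K2E3GL3ConjugacyCountShift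

namespace Summit.HodgeConjecture.HodgeConjecture.Cruxes.H413.K2E3GL3ModUniformizerBallBoundMixed

variable {F : Type*} [Field F] [Valued F ℤᵐ⁰] [ValuativeRel F] [(Valued.v : Valuation F ℤᵐ⁰).Compatible] [IsNonarchimedeanLocalField F]
  [MeasurableSpace (GL (Fin 3) F)] [BorelSpace (GL (Fin 3) F)]
  {ϖ : F} (hϖ : Valued.v ϖ = WithZero.exp (-1 : ℤ)) (hϖ0 : ϖ ≠ 0)
  [((Subgroup.zpowers (Units.mk0 ϖ hϖ0)).map (Matrix.GeneralLinearGroup.scalar (Fin 3))).Normal]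
  [MeasurableSpace (GL (Fin 3) F ⧸ (Subgroup.zpowers (Units.mk0 ϖ hϖ0)).map (Matrix.GeneralLinearGroup.scalar (Fin 3)))]
  [BorelSpace (GL (Fin 3) F ⧸ (Subgroup.zpowers (Units.mk0 ϖ hϖ0)).map (Matrix.GeneralLinearGroup.scalar (Fin 3)))]
  (μ' : Measure (GL (Fin 3) F ⧸ (Subgroup.zpowers (Units.mk0 ϖ hϖ0)).map (Matrix.GeneralLinearGroup.scalar (Fin 3)))) [μ'.IsHaarMeasure]

include hϖ in
/-- **THE BALL BOUND AT A MIXED-REGULAR POINT.**  There are constants `c : ℝ≥0` and `C : ℕ → ℝ≥0∞` (`C m < ∞`) such that for every bounded `θ` (`‖θ‖ ≤ M_θ`) vanishing off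
`Ω m`, every rootless `π = X² − TX + N₀` (`2 ≠ 0`), `c ≠ 0` with `π(c) ≠ 0`, `γ` with `(γ : Matrix) = !![0, −N₀, 0; 1, T, 0; 0, 0, c]`, every `y` with `y γ y⁻¹` INTEGRAL, every
`L` with `|ϖ^L| ≤ |disc π · π(c)²|`, exponents `B, l` with `|c(ϖ^m)⁻¹| = (q⁻¹)^B`, `(q⁻¹)^l ≤ |π|`, and every radius `R`:
`∫_{Ω R} ‖θ(x̄ · mk(y γ y⁻¹) · x̄⁻¹)‖ dμ' ≤ M_θ · (c · (C m · 3(2(R+L)+1)² · (‖c²/π(c)‖·|2|⁻¹(q⁻¹)^{B−l+⌊l/2⌋}))).toReal`.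
[cite: HarishChandra1970, Part VII §2 Theorem 18 p. 69; §3 p. 72] -/
theorem exists_setIntegral_norm_conj_le_mixed {E : Type*} [NormedAddCommGroup E] (h2 : (2 : F) ≠ 0)
    (Ω : ℕ → Set (GL (Fin 3) F ⧸ (Subgroup.zpowers (Units.mk0 ϖ hϖ0)).map (Matrix.GeneralLinearGroup.scalar (Fin 3))))
    (hmem : ∀ (n : ℕ) (z : GL (Fin 3) F),
      (QuotientGroup.mk z : GL (Fin 3) F ⧸ (Subgroup.zpowers (Units.mk0 ϖ hϖ0)).map (Matrix.GeneralLinearGroup.scalar (Fin 3))) ∈ Ω n ↔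
        ∀ i j k l, Valued.v (ϖ ^ n * ((z : Matrix (Fin 3) (Fin 3) F) i j * ((z⁻¹ : GL (Fin 3) F) : Matrix (Fin 3) (Fin 3) F) k l)) ≤ 1) :
    ∃ (c : ℝ≥0) (C : ℕ → ℝ≥0∞), (∀ m, C m ≠ ⊤) ∧
      ∀ (θ : GL (Fin 3) F ⧸ (Subgroup.zpowers (Units.mk0 ϖ hϖ0)).map (Matrix.GeneralLinearGroup.scalar (Fin 3)) → E) (Mθ : ℝ) (m : ℕ),
        (∀ x, ‖θ x‖ ≤ Mθ) → (∀ x, x ∉ Ω m → θ x = 0) →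
        ∀ (T N₀ c₀ : F), (∀ x : F, x ^ 2 - T * x + N₀ ≠ 0) → c₀ ≠ 0 → c₀ ^ 2 - T * c₀ + N₀ ≠ 0 →
        ∀ (γ : GL (Fin 3) F), (γ : Matrix (Fin 3) (Fin 3) F) = !![0, -N₀, 0; 1, T, 0; 0, 0, c₀] →
        ∀ (y : GL (Fin 3) F) (L R : ℕ) (B : ℤ) (l : ℕ),
          (∀ i j, Valued.v (((y * γ * y⁻¹ : GL (Fin 3) F) : Matrix (Fin 3) (Fin 3) F) i j) ≤ 1) →
          Valued.v (ϖ ^ L) ≤ Valued.v ((T ^ 2 - 4 * N₀) * (c₀ ^ 2 - T * c₀ + N₀) ^ 2) →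
          normAbs F (c₀ * (ϖ ^ m)⁻¹) = ((residueFieldCard F : ℝ≥0)⁻¹) ^ B → (∀ x : F, ((residueFieldCard F : ℝ≥0)⁻¹) ^ (l : ℤ) ≤ normAbs F (x ^ 2 - T * x + N₀)) →
          ∫ x in Ω R, ‖θ (x * QuotientGroup.mk (y * γ * y⁻¹) * x⁻¹)‖ ∂μ' ≤
            Mθ * ((c : ℝ≥0∞) * (C m * ((3 * (2 * (R + L) + 1) ^ 2 : ℕ) : ℝ≥0∞) *
              ((normAbs F (c₀ ^ 2 / (c₀ ^ 2 - T * c₀ + N₀)) * ((normAbs F (2 : F))⁻¹ * ((residueFieldCard F : ℝ≥0)⁻¹) ^ (B - l + l / 2)) : ℝ≥0) : ℝ≥0∞))).toReal := by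
  -- a Haar measure upstairs
  haveI : T2Space F := (isLocalField F).toT2Space
  haveI : LocallyCompactSpace F := (isLocalField F).toLocallyCompactSpace
  haveI : IsTopologicalRing F := inferInstance
  haveI : LocallyCompactSpace (Matrix (Fin 3) (Fin 3) F) := inferInstanceAs (LocallyCompactSpace (Fin 3 → Fin 3 → F))
  haveI : LocallyCompactSpace (GL (Fin 3) F) := inferInstance
  set ν : Measure (GL (Fin 3) F) := Measure.haar with hν
  obtain ⟨c, hc⟩ := setIntegral_norm_comp_conj_le_adBall (E := E) hϖ hϖ0 ν μ' Ω hmem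
  obtain ⟨C, hC, hV⟩ := exists_measure_window_adBall_conj_leviBlock_le hϖ h2 ν
  refine ⟨c, C, hC, fun θ Mθ m hM hsupp T N₀ c₃ hπ hc₃ hπc γ hγ y L R B l hy hL hB hl => ?_⟩
  -- 1. transfer to the upstairs count at `g = y γ y⁻¹`
  refine (hc θ Mθ m hM hsupp (y * γ * y⁻¹) R).trans ?_
  have hM0 : 0 ≤ Mθ := (norm_nonneg _).trans (hM 1)
  refine mul_le_mul_of_nonneg_left (ENNReal.toReal_mono ?_ ?_) hM0
  · exact ENNReal.mul_ne_top ENNReal.coe_ne_top (ENNReal.mul_ne_top (ENNReal.mul_ne_top (hC m) (ENNReal.natCast_ne_top _)) ENNReal.coe_ne_top)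
  gcongr
  -- 2. Theorem 18 (mixed): a conjugator `y′ = y t`, `t ∈ Z(γ)`, of height `L`
  obtain ⟨t, ht, hyt⟩ := exists_adBall_mul_centralizer_of_conj_integral_mixed hϖ0 hγ hπ hy hL
  have hg : y * γ * y⁻¹ = (y * t) * γ * (y * t)⁻¹ := by
    rw [_root_.mul_inv_rev, mul_assoc y t γ, ht, ← mul_assoc y γ t, mul_assoc (y * γ) t (t⁻¹ * y⁻¹), mul_inv_cancel_left]
  rw [hg]
  -- 3. the conjugator shift, 4. the mixed volume count
  set W : Finset ℤ := Finset.Icc (-2 : ℤ) 0 with hW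
  have hset : {z : GL (Fin 3) F | WithZero.log (Valued.v (z : Matrix (Fin 3) (Fin 3) F).det) ∈ Set.Icc (-2 : ℤ) 0 ∧
      (∀ i j k l', Valued.v (ϖ ^ R * ((z : Matrix (Fin 3) (Fin 3) F) i j * ((z⁻¹ : GL (Fin 3) F) : Matrix (Fin 3) (Fin 3) F) k l')) ≤ 1) ∧
      ∀ i j k l', Valued.v (ϖ ^ m * (((z * ((y * t) * γ * (y * t)⁻¹) * z⁻¹ : GL (Fin 3) F) : Matrix (Fin 3) (Fin 3) F) i j *
        (((z * ((y * t) * γ * (y * t)⁻¹) * z⁻¹)⁻¹ : GL (Fin 3) F) : Matrix (Fin 3) (Fin 3) F) k l')) ≤ 1} =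
      {z : GL (Fin 3) F | WithZero.log (Valued.v (z : Matrix (Fin 3) (Fin 3) F).det) ∈ W ∧
      (∀ i j k l', Valued.v (ϖ ^ R * ((z : Matrix (Fin 3) (Fin 3) F) i j * ((z⁻¹ : GL (Fin 3) F) : Matrix (Fin 3) (Fin 3) F) k l')) ≤ 1) ∧
      ∀ i j k l', Valued.v (ϖ ^ m * (((z * ((y * t) * γ * (y * t)⁻¹) * z⁻¹ : GL (Fin 3) F) : Matrix (Fin 3) (Fin 3) F) i j *
        (((z * ((y * t) * γ * (y * t)⁻¹) * z⁻¹)⁻¹ : GL (Fin 3) F) : Matrix (Fin 3) (Fin 3) F) k l')) ≤ 1} := by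
    ext z
    simp only [Set.mem_setOf_eq, hW, Set.mem_Icc, Finset.mem_Icc]
  rw [hset]
  refine (measure_window_adBall_conj_conj_le_of_isHaarMeasure ν hyt γ W R m).trans ?_
  refine (hV T N₀ c₃ hπ hc₃ hπc γ hγ _ (R + L) m B l hB hl).trans (le_of_eq ?_)
  rw [card_image_add_right, hW, Int.card_Icc, show ((0 : ℤ) + 1 - -2).toNat = 3 by decide]

end Summit.HodgeConjecture.HodgeConjecture.Cruxes.H413.K2E3GL3ModUniformizerBallBoundMixed

end
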